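import Literature.Probability.RandomPlanarGeometry.HexSAWBrickWallSlabLocality
import HarnessLib

/-!
# Up-walks of the brick wall ARE Duminil-Copin–Smirnov's strip bridges by length: `#upWalks n = b_n(ℍ)` (`n ≥ 1`)

Topic `Literature/Probability/RandomPlanarGeometry` (continues `HexSAWBrickWallSlabLocality.lean` — the transport
`HV.toUpWalk` of a completed strip bridge with `n` vertices to an up-walk with `n` steps, injective, whence
`SAW.hvBridgeLen_le_card_upWalks : b_n(ℍ) ≤ #HexBW.upWalks n` — and `HexSAWBrickWallSlabUpWalks.lean`: `HexBW.upWalks n`, the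
`n`-step self-avoiding shapes which, placed at `e = (1,0)`, use brick-wall bonds, keep rows `≥ 0` and reach their top row only at
the last step).  Sources: H. Duminil-Copin, S. Smirnov, Ann. of Math. 175 (2012), §3 (the strips `S_T` and their bridges = the walks
`a → β`); N. Madras, G. Slade, *The Self-Avoiding Walk* (1993), Definition 1.2.4 (bridges, p. 11); I. G. Enting, I. Jensen, LNP 775
(2009), §7.4.2 Fig. 7.10 (brickwork form of the honeycomb lattice).

## What is proved (the inverse reading; lane dictionary, no novelty)

For `υ ∈ HexBW.upWalks n`, `n ≥ 1`, the vertex list `HexBW.toHVList n υ = [rowIso ((−1,0) + υ 0), …, rowIso ((−1,0) + υ (n−1))]`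
(the placed walk at `hvToRow O = (−1,0)`, the last vertex dropped, read in Duminil-Copin–Smirnov's coordinates through the
rotated dictionary `HexBW.rowIso`) is a bridge of width `T = υ_n₁` with `n` vertices of the strip `S_{T,n}` (`toHVList_mem_bridgeLists`):
a self-avoiding `hvGraph`-chain from `O` in the levels `0,…,2T−1` ending on the level `2T−1` (the last step of an up-walk is its
vertical exit bond, from an even site of the row `T−1`).  The reading is injective (`toHVList_injOn`: the dropped last vertex is
the site above the last kept one), the width lies in `[1, n]`, so `#upWalks n ≤ Σ_T #{bridges of width T with n vertices} = b_n(ℍ)`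
(`card_upWalks_le_hvBridgeLen`), and with the transport of the previous file **`card_upWalks_eq_hvBridgeLen : #upWalks n = b_n(ℍ)`**
for `n ≥ 1` (`#upWalks 0 = 1`, `b_0 = 0`).  Numerical face (lane refute-first, a-ref-1 g44, 2026-08-23): `#upWalks n = 2, 6, 18, 54, 170, 542`
for `n = 2, 4, …, 12`, `0` for odd `n` — the tree's `b_n(ℍ)` (`HexSAWBridgeLength.lean` header).
-/

noncomputable section

open Finset Filter Literature.Probability.LatticeModels Literature.Probability.Percolation SimpleGraph

namespace Literature.Probability.RandomPlanarGeometry.SAW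

namespace HexBW

/-- The base site `(−1, 0) = hvToRow O` at which the up-walk is placed for the reading. [cite: EntingJensen2009, §7.4.2, Fig. 7.10] -/
def bwO : Site 2 := fun i => if i = 0 then -1 else 0

/-- `bwO₀ = −1`. [cite: EntingJensen2009, §7.4.2, Fig. 7.10] -/
@[simp] theorem bwO_apply_zero : bwO 0 = -1 := if_pos rfl

/-- `bwO₁ = 0`. [cite: EntingJensen2009, §7.4.2, Fig. 7.10] -/
@[simp] theorem bwO_apply_one : bwO 1 = 0 := if_neg (by decide)

/-- `bwO = hvToRow O`. [cite: EntingJensen2009, §7.4.2, Fig. 7.10] -/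
theorem bwO_eq : bwO = hvToRow hvOrigin := by
  funext i; fin_cases i
  · show bwO 0 = hvToRow hvOrigin 0; rw [bwO_apply_zero, hvToRow_apply_zero]; rfl
  · show bwO 1 = hvToRow hvOrigin 1; rw [bwO_apply_one, hvToRow_apply_one]; rfl

/-- `rowIso bwO = O`. [cite: EntingJensen2009, §7.4.2, Fig. 7.10] -/
theorem rowToHV_bwO : rowToHV bwO = hvOrigin := by
  rw [bwO_eq, rowToHV_hvToRow]

/-- `bwO` and `bwE = (1,0)` differ by the even vector `(2,0)`: the placement at `bwO` uses brick-wall bonds iff the placement at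
`bwE` does. [cite: EntingJensen2009, §7.4.2, Fig. 7.10] -/
theorem adj_bwO_add_iff (x y : Site 2) :
    brickWallGraph.Adj (bwO + x) (bwO + y) ↔ brickWallGraph.Adj (bwE + x) (bwE + y) := by
  simp only [brickWallGraph_adj_coord, Pi.add_apply, bwO_apply_zero, bwO_apply_one, bwE_apply_zero, bwE_apply_one]
  omega

/-- **The Duminil-Copin–Smirnov reading of an up-walk**: the first `n` vertices of the walk placed at `(−1,0)`, in the
coordinates of `hvGraph`. [cite: DuminilCopinSmirnov2012, §3 (bridges of S_T)] -/
def toHVList (n : ℕ) (υ : ℕ → Site 2) : List HV := (List.range n).map fun i => rowToHV (bwO + υ i)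

/-- Length of the reading. [cite: DuminilCopinSmirnov2012, §3] -/
@[simp] theorem length_toHVList (n : ℕ) (υ : ℕ → Site 2) : (toHVList n υ).length = n := by
  simp [toHVList]

/-- Elements of the reading. [cite: DuminilCopinSmirnov2012, §3] -/
theorem getElem_toHVList (n : ℕ) (υ : ℕ → Site 2) {i : ℕ} (hi : i < (toHVList n υ).length) :
    (toHVList n υ)[i] = rowToHV (bwO + υ i) := by
  simp [toHVList]

/-- Membership in the reading. [cite: DuminilCopinSmirnov2012, §3] -/
theorem mem_toHVList {n : ℕ} {υ : ℕ → Site 2} {w : HV} : w ∈ toHVList n υ ↔ ∃ i < n, rowToHV (bwO + υ i) = w := by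
  simp [toHVList]

/-- Rows, parities and columns along an up-walk (the facts used by the reading): every row `υ_i₁`, `i < n`, is in `[0, T−1]`
(`T = υ_n₁`), the row of `υ_{n−1}` is `T − 1` with `υ_{n−1} + e` of even parity and `υ_n = υ_{n−1} + (0,1)`, and `|υ_i₀| ≤ i`.
[cite: MadrasSlade1993, Definition 1.2.4 (p. 11)] -/
theorem upWalks_last_step {n : ℕ} {υ : ℕ → Site 2} (hυ : υ ∈ upWalks n) (hn : 1 ≤ n) :
    υ (n - 1) 1 + 1 = υ n 1 ∧ υ (n - 1) 0 = υ n 0 ∧ (bwO 0 + υ (n - 1) 0 + (bwO 1 + υ (n - 1) 1)) % 2 = 0 := by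
  obtain ⟨-, hbw, hr⟩ := mem_upWalks.1 hυ
  have h1 := hr (n - 1) (by omega)
  have hadj := hbw (n - 1) (by omega)
  rw [Nat.sub_add_cancel hn, brickWallGraph_adj_coord] at hadj
  simp only [Pi.add_apply, bwE_apply_zero, bwE_apply_one, bwO_apply_zero, bwO_apply_one] at hadj ⊢
  omega

/-- `rowToHV` is injective. [cite: EntingJensen2009, §7.4.2, Fig. 7.10] -/
theorem rowToHV_injective : Function.Injective rowToHV := fun x y h => by
  have := congrArg hvToRow h
  rwa [hvToRow_rowToHV, hvToRow_rowToHV] at this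

/-- A brick-wall site with row in `[0, T−1]` and column in `[−L, L]` is read into the strip `S_{T,L}`.
[cite: DuminilCopinSmirnov2012, §3 (S_{T,L})] -/
theorem rowToHV_mem_stripV {T L : ℕ} {z : Site 2} (h0 : 0 ≤ z 1) (h1 : z 1 + 1 ≤ (T : ℤ)) (h2 : -(L : ℤ) ≤ z 0)
    (h3 : z 0 ≤ (L : ℤ)) : rowToHV z ∈ HV.stripV T L := by
  rw [HV.mem_stripV_iff]
  by_cases hpar : (z 0 + z 1) % 2 = 0
  · simp only [rowToHV, hpar, decide_true, HV.lev_mk, HV.bit_true]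
    omega
  · simp only [rowToHV, decide_eq_false hpar, HV.lev_mk, HV.bit_false]
    omega

/-- The level of the reading of an EVEN site of the row `b` is `2b + 1`. [cite: DuminilCopinSmirnov2012, §3 (Fig. 3: levels)] -/
theorem lev_rowToHV_of_even {z : Site 2} (h : (z 0 + z 1) % 2 = 0) : HV.lev (rowToHV z) = 2 * z 1 + 1 := by
  simp only [rowToHV, h, decide_true, HV.lev_mk, HV.bit_true]

/-- **The reading of an up-walk with `n ≥ 1` steps is a Duminil-Copin–Smirnov bridge of width `T = υ_n₁` with `n` vertices**,
and `1 ≤ T ≤ n`. [cite: DuminilCopinSmirnov2012, §3 (bridges of S_{T,L}); MadrasSlade1993, Definition 1.2.4 (p. 11)] -/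
theorem toHVList_mem_bridgeLists {n : ℕ} {υ : ℕ → Site 2} (hυ : υ ∈ upWalks n) (hn : 1 ≤ n) :
    toHVList n υ ∈ HV.bridgeLists (υ n 1).toNat n ∧ 1 ≤ (υ n 1).toNat ∧ (υ n 1).toNat ≤ n := by
  obtain ⟨hs, hbw, hr⟩ := mem_upWalks.1 hυ
  obtain ⟨h0, -, hadj, hinj⟩ := Zd.mem_saws.1 hs
  obtain ⟨hlast1, hlast0, hpar⟩ := upWalks_last_step hυ hn
  have hrow0 : 0 ≤ υ (n - 1) 1 := (hr (n - 1) (by omega)).1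
  have hT : ((υ n 1).toNat : ℤ) = υ n 1 := Int.toNat_of_nonneg (by omega)
  have habs : ∀ i ≤ n, ∀ j, |υ i j| ≤ (i : ℤ) := Zd.abs_apply_le_of_adj h0 hadj
  have hTn : (υ n 1).toNat ≤ n := by
    have := habs n le_rfl 1
    rw [abs_le] at this
    omega
  have hne : toHVList n υ ≠ [] := by
    rw [ne_eq, ← List.length_eq_zero_iff, length_toHVList]; omega
  refine ⟨(HV.mem_bridgeLists_iff (by omega)).2 ⟨?_, ?_, ?_, ?_, hne, ?_⟩, by omega, hTn⟩
  · -- chain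
    rw [toHVList, List.isChain_map, List.isChain_range]
    intro m hm
    show hvGraph.Adj (rowToHV (bwO + υ m)) (rowToHV (bwO + υ m.succ))
    rw [adj_rowToHV_iff, adj_bwO_add_iff]
    exact hbw m (by omega)
  · -- head
    rw [toHVList]
    obtain ⟨m, rfl⟩ : ∃ m, n = m + 1 := ⟨n - 1, by omega⟩
    rw [List.range_succ_eq_map, List.map_cons, List.head?_cons, h0, add_zero, rowToHV_bwO]
  · -- nodup
    rw [toHVList]
    refine List.Nodup.map_on (fun i hi j hj hij => ?_) (List.nodup_range)
    rw [List.mem_range] at hi hj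
    have h1 : bwO + υ i = bwO + υ j := rowToHV_injective hij
    exact hinj (show i ∈ {k | k ≤ n} by simp only [Set.mem_setOf_eq]; omega)
      (show j ∈ {k | k ≤ n} by simp only [Set.mem_setOf_eq]; omega) (add_left_cancel h1)
  · -- in the strip `S_{T,n}`
    intro w hw
    obtain ⟨i, hi, rfl⟩ := mem_toHVList.1 hw
    have hri := hr i hi
    have hai := habs i (by omega) 0
    rw [abs_le] at hai
    refine rowToHV_mem_stripV ?_ ?_ ?_ ?_ <;>
      simp only [Pi.add_apply, bwO_apply_zero, bwO_apply_one] <;> omega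
  · -- the last vertex is on the level `2T − 1`
    rw [List.getLast_eq_getElem, getElem_toHVList]
    simp only [length_toHVList]
    rw [lev_rowToHV_of_even (by simpa only [Pi.add_apply] using hpar), Pi.add_apply, bwO_apply_one, hT]
    omega

/-- **The reading is injective** on the up-walks with `n ≥ 1` steps (the dropped last vertex is `υ_{n−1} + (0,1)`).
[cite: MadrasSlade1993, Definition 1.2.4 (p. 11)] -/
theorem toHVList_injOn {n : ℕ} (hn : 1 ≤ n) : Set.InjOn (toHVList n) ↑(upWalks n) := by
  intro υ hυ υ' hυ' h
  rw [Finset.mem_coe] at hυ hυ'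
  obtain ⟨-, hend, -, -⟩ := Zd.mem_saws.1 (mem_upWalks.1 hυ).1
  obtain ⟨-, hend', -, -⟩ := Zd.mem_saws.1 (mem_upWalks.1 hυ').1
  obtain ⟨hl1, hl0, -⟩ := upWalks_last_step hυ hn
  obtain ⟨hl1', hl0', -⟩ := upWalks_last_step hυ' hn
  have hlt : ∀ i < n, υ i = υ' i := fun i hi => by
    have h1 := congrArg (fun l => l[i]?) h
    simp only [toHVList, List.getElem?_map, List.getElem?_range hi, Option.map_some, Option.some.injEq] at h1
    exact add_left_cancel (rowToHV_injective h1)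
  have hnn : υ n = υ' n := by
    have := hlt (n - 1) (by omega)
    funext j; fin_cases j
    · show υ n 0 = υ' n 0
      rw [← hl0, ← hl0', this]
    · show υ n 1 = υ' n 1
      rw [← hl1, ← hl1', this]
  funext i
  rcases lt_trichotomy i n with hi | rfl | hi
  · exact hlt i hi
  · exact hnn
  · rw [hend i hi.le, hend' i hi.le, hnn]

end HexBW

/-- **`#upWalks n ≤ b_n(ℍ)`** (`n ≥ 1`): the reading sends the up-walks with `n` steps injectively into the Duminil-Copin–Smirnov
strip bridges with `n` vertices, graded by their width `T = υ_n₁ ∈ [1, n]`. [cite: DuminilCopinSmirnov2012, §3; MadrasSlade1993, Definition 1.2.4] -/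
theorem card_upWalks_le_hvBridgeLen {n : ℕ} (hn : 1 ≤ n) : (HexBW.upWalks n).card ≤ hvBridgeLen n := by
  classical
  unfold hvBridgeLen
  -- fibre the up-walks over the width
  have hmaps : Set.MapsTo (fun υ : ℕ → Site 2 => (υ n 1).toNat) ↑(HexBW.upWalks n) ↑(Icc 1 n) := fun υ hυ => by
    obtain ⟨-, h1, h2⟩ := HexBW.toHVList_mem_bridgeLists (Finset.mem_coe.1 hυ) hn
    exact Finset.mem_coe.2 (mem_Icc.2 ⟨h1, h2⟩)
  rw [Finset.card_eq_sum_card_fiberwise hmaps]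
  refine Finset.sum_le_sum fun T hT => ?_
  refine Finset.card_le_card_of_injOn (HexBW.toHVList n) (fun υ hυ => ?_) ?_
  · rw [Finset.mem_coe, Finset.mem_filter] at hυ
    obtain ⟨hυ, rfl⟩ := hυ
    rw [Finset.mem_coe, Finset.mem_filter]
    exact ⟨(HexBW.toHVList_mem_bridgeLists hυ hn).1, HexBW.length_toHVList n υ⟩
  · intro υ hυ υ' hυ' h
    rw [Finset.mem_coe, Finset.mem_filter] at hυ hυ'
    exact HexBW.toHVList_injOn hn (Finset.mem_coe.2 hυ.1) (Finset.mem_coe.2 hυ'.1) h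

/-- **Up-walks are the strip bridges by length: `#upWalks n = b_n(ℍ)` for `n ≥ 1`** (both readings are injective).
[cite: DuminilCopinSmirnov2012, §3 (bridges of S_T); MadrasSlade1993, Definition 1.2.4 (p. 11)] -/
theorem card_upWalks_eq_hvBridgeLen {n : ℕ} (hn : 1 ≤ n) : (HexBW.upWalks n).card = hvBridgeLen n :=
  le_antisymm (card_upWalks_le_hvBridgeLen hn) (hvBridgeLen_le_card_upWalks n)

/-- In particular `(#upWalks n/(2n+1))^{1/n} ≤ μ(Slab_{6n+1})` is the same inequality as Madras–Slade's (8.2.14) with `b_n(ℍ)`.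
[cite: MadrasSlade1993, §8.2, proof of Theorem 8.2.1, (8.2.14) (p. 269)] -/
theorem card_upWalks_div_rpow_le_slabConnectiveConstant {n : ℕ} (hn : 1 ≤ n) :
    (((HexBW.upWalks n).card : ℝ) / (2 * n + 1)) ^ (1 / (n : ℝ)) ≤ HexBW.slabConnectiveConstant (6 * n + 1) := by
  rw [card_upWalks_eq_hvBridgeLen hn]
  exact HexBW.hvBridgeLen_div_rpow_le_slabConnectiveConstant hn


end Literature.Probability.RandomPlanarGeometry.SAW
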